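import Literature.NumberTheory.BeurlingPrimes.ZetaIntegerCoefficients
import Mathlib.Analysis.SpecialFunctions.Exponential
import Mathlib.NumberTheory.Harmonic.Defs
import HarnessLib

/-!
# `x log x (d/dx) li(x^z) = Σ_{n≥1} zⁿ(log x)ⁿ/(n! ζ(n+1))` for complex `z`: Möbius splitting and estimates

Topic `Literature/NumberTheory/BeurlingPrimes`. Everything in this file is PROVED.

For a complex exponent `z` Broucke–Debruyne–Révész (2023, §2 (2.5)–(2.6)) use
`x log x (d/dx) li(x^z) = Σ_{k≥1} (μ(k)/k)(x^{z/k} − 1) = Σ_{n≥1} zⁿ(log x)ⁿ/(n! ζ(n+1))`, and in the proof of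
Lemma 3.1 the estimate `|x log x (d/dx) li(x^z) − (x^z − 1)| ≪_Q √x log log x` (`|z| ≤ Q`, `0 < Re z ≤ 1`), obtained by
splitting the Möbius sum. Here the right-hand series is `liKernel z (log x)` and we prove, with a FIXED splitting
parameter `K` (so that only finite Möbius sums occur, the coefficients being split by
`Literature.NumberTheory.BeurlingPrimes.abs_inv_zetaN_sub_sum_le`):

* `liKernel z L = Σ_{n≥1} (zL)ⁿ/(n! ζ(n+1))` (`invZetaCoeff n = 1/ζ(n+1)`, `n ≥ 1`), absolutely convergent;
* `liKernel_eq_sum_add` — **`liKernel z L = Σ_{k=1}^{K} (μ(k)/k)(e^{zL/k} − 1) + T`, `‖T‖ ≤ e^{‖z‖|L|/K} − 1`** (`K ≥ 1`);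
* `abs_re_liKernel_sub_le` — for `Re z ≤ 1`, `x ≥ 1`, `K ≥ 1`, `K ≥ 2‖z‖`:
  **`|Re liKernel z (log x) − Re(x^z − 1)| ≤ H_K (√x + 1)`**, `H_K = harmonic K` (BDR's `≪_Q √x log log x` with the
  choice `K ≈ Q log x`; a fixed `K` suffices for Lemma 3.1 and for the Chebyshev bounds);
* `re_liKernel_eq_logSeries` — `Re liKernel z L = logSeries (n ↦ invZetaCoeff n · Re zⁿ) L` (the tree's real power
  series in `log x`, `LogPowerSeries.lean`), and `re_exp_sub_one_eq_logSeries` for `Re(e^{zL} − 1)`;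
* the real case `0 ≤ δ`: `δL/2 ≤ liKernel δ L ≤ e^{δL} − 1` for `L ≥ 0` (`half_mul_le_re_liKernel`,
  `re_liKernel_le_exp_sub_one`; BDR (2.7)).

## References
* [BrouckeDebruyneRevesz2023] F. Broucke, G. Debruyne, Sz. Gy. Révész, *Some examples of well-behaved Beurling
  number systems*, arXiv:2309.01567, §2 (2.5)–(2.7) and proof of Lemma 3.1 (read).
-/

noncomputable section

open Filter Topology ArithmeticFunction Complex
open scoped ArithmeticFunction.Moebius Nat

namespace Literature.NumberTheory.BeurlingPrimes

/-! ### The exponential series without its constant term -/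

/-- `Σ_{n≥0} w^{n+1}/(n+1)! = e^w − 1` in `ℂ`. [folklore] -/
theorem hasSum_pow_succ_div_factorial (w : ℂ) :
    HasSum (fun n : ℕ ↦ w ^ (n + 1) / (n + 1)!) (Complex.exp w - 1) := by
  have h : HasSum (fun n : ℕ ↦ w ^ n / n !) (Complex.exp w) := by
    rw [Complex.exp_eq_exp_ℂ]
    exact NormedSpace.expSeries_div_hasSum_exp w
  have h1 := (hasSum_nat_add_iff' 1).mpr h
  simpa using h1

/-- `Σ_{n≥1} wⁿ/n! = e^w − 1` in `ℂ`, the `n = 0` term set to `0`. [folklore] -/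
theorem hasSum_ite_pow_div_factorial (w : ℂ) :
    HasSum (fun n : ℕ ↦ if n = 0 then 0 else w ^ n / n !) (Complex.exp w - 1) := by
  rw [← hasSum_nat_add_iff' 1]
  simpa using hasSum_pow_succ_div_factorial w

/-- `Σ_{n≥1} rⁿ/n! = e^r − 1` in `ℝ`, the `n = 0` term set to `0`. [folklore] -/
theorem real_hasSum_ite_pow_div_factorial (r : ℝ) :
    HasSum (fun n : ℕ ↦ if n = 0 then 0 else r ^ n / n !) (Real.exp r - 1) := by
  have h : HasSum (fun n : ℕ ↦ r ^ n / n !) (Real.exp r) := by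
    rw [Real.exp_eq_exp_ℝ]
    exact NormedSpace.expSeries_div_hasSum_exp r
  rw [← hasSum_nat_add_iff' 1]
  have h1 := (hasSum_nat_add_iff' 1).mpr h
  simpa using h1

/-! ### The coefficients `1/ζ(n+1)` and the series `liKernel` -/

/-- `invZetaCoeff n = 1/ζ(n+1)` for `n ≥ 1`, `0` for `n = 0`: the coefficients of BDR (2.6).
[cite: BrouckeDebruyneRevesz2023, §2 (2.6)] -/
def invZetaCoeff (n : ℕ) : ℝ := if n = 0 then 0 else (zetaN (n + 1))⁻¹

/-- `0 ≤ invZetaCoeff n ≤ 1`. [cite: BrouckeDebruyneRevesz2023, §2] -/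
theorem invZetaCoeff_nonneg (n : ℕ) : 0 ≤ invZetaCoeff n := by
  unfold invZetaCoeff; split_ifs with h
  · exact le_rfl
  · exact (inv_zetaN_pos (by omega)).le

/-- `invZetaCoeff n ≤ 1`. [cite: BrouckeDebruyneRevesz2023, §2] -/
theorem invZetaCoeff_le_one (n : ℕ) : invZetaCoeff n ≤ 1 := by
  unfold invZetaCoeff; split_ifs with h
  · exact zero_le_one
  · exact inv_zetaN_le_one (by omega)

/-- `|invZetaCoeff n| ≤ 1`. [folklore] -/
theorem abs_invZetaCoeff_le_one (n : ℕ) : |invZetaCoeff n| ≤ 1 := by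
  rw [abs_of_nonneg (invZetaCoeff_nonneg n)]; exact invZetaCoeff_le_one n

/-- **`liKernel z L = Σ_{n≥1} (zL)ⁿ/(n! ζ(n+1))`** (`= x log x (d/dx) li(x^z)` at `L = log x`, BDR (2.6)).
[cite: BrouckeDebruyneRevesz2023, §2 (2.6)] -/
def liKernel (z : ℂ) (L : ℝ) : ℂ := ∑' n : ℕ, (invZetaCoeff n : ℂ) * (z * L) ^ n / n !

/-- Norm bound for a series with bounded real coefficients: `‖c (w)ⁿ/n!‖ ≤ B ‖w‖ⁿ/n!` if `|c| ≤ B`. [folklore] -/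
theorem norm_coeff_mul_pow_div_le {c B : ℝ} (hc : |c| ≤ B) (w : ℂ) (n : ℕ) :
    ‖(c : ℂ) * w ^ n / (n ! : ℂ)‖ ≤ B * (‖w‖ ^ n / n !) := by
  rw [norm_div, norm_mul, norm_real, norm_pow, Real.norm_eq_abs, Complex.norm_natCast, mul_div_assoc]
  exact mul_le_mul_of_nonneg_right hc (by positivity)

/-- Summability of a series `Σ c n wⁿ/n!` with `|c n| ≤ B`. [folklore] -/
theorem summable_coeff_mul_pow_div {c : ℕ → ℝ} {B : ℝ} (hc : ∀ n, |c n| ≤ B) (w : ℂ) :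
    Summable fun n : ℕ ↦ (c n : ℂ) * w ^ n / n ! :=
  Summable.of_norm_bounded ((Real.summable_pow_div_factorial ‖w‖).mul_left B)
    fun n ↦ norm_coeff_mul_pow_div_le (hc n) w n

/-- The defining series of `liKernel` converges (absolutely). [folklore] -/
theorem hasSum_liKernel (z : ℂ) (L : ℝ) :
    HasSum (fun n : ℕ ↦ (invZetaCoeff n : ℂ) * (z * L) ^ n / n !) (liKernel z L) :=
  (summable_coeff_mul_pow_div abs_invZetaCoeff_le_one _).hasSum

/-! ### The Möbius splitting `liKernel = Σ_{k ≤ K} (μ(k)/k)(e^{zL/k} − 1) + T` -/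

/-- The finite Möbius part of the coefficient: `Σ_{k=0}^{K} μ(k)/k^{n+1}` (`n ≥ 1`), `0` for `n = 0`. [folklore] -/
def moebPart (K n : ℕ) : ℝ := if n = 0 then 0 else ∑ k ∈ Finset.range (K + 1), (μ k : ℝ) / (k : ℝ) ^ (n + 1)

/-- The remainder of the coefficient: `invZetaCoeff n − moebPart K n`. [folklore] -/
def moebRem (K n : ℕ) : ℝ := invZetaCoeff n - moebPart K n

/-- `|moebPart K n| ≤ K + 1`. [folklore] -/
theorem abs_moebPart_le (K n : ℕ) : |moebPart K n| ≤ K + 1 := by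
  unfold moebPart; split_ifs with h
  · simp; positivity
  · refine (Finset.abs_sum_le_sum_abs _ _).trans ?_
    calc ∑ k ∈ Finset.range (K + 1), |(μ k : ℝ) / (k : ℝ) ^ (n + 1)|
        ≤ ∑ k ∈ Finset.range (K + 1), (1 : ℝ) := Finset.sum_le_sum fun k _ ↦ by
          rw [abs_div, abs_pow, Nat.abs_cast]
          rcases Nat.eq_zero_or_pos k with rfl | hk
          · simp
          · have h1 : |(μ k : ℝ)| ≤ 1 := by exact_mod_cast abs_moebius_le_one
            have h2 : (1 : ℝ) ≤ (k : ℝ) ^ (n + 1) := one_le_pow₀ (by exact_mod_cast hk)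
            exact (div_le_one (by positivity)).2 (h1.trans h2)
      _ = K + 1 := by simp

/-- **`|moebRem K n| ≤ K^{−n}`** for `K ≥ 1` (all `n`; trivial for `n = 0`):
`Literature.NumberTheory.BeurlingPrimes.abs_inv_zetaN_sub_sum_le`. [cite: BrouckeDebruyneRevesz2023, proof of Lemma 3.1] -/
theorem abs_moebRem_le {K : ℕ} (hK : 1 ≤ K) (n : ℕ) : |moebRem K n| ≤ ((K : ℝ) ^ n)⁻¹ := by
  unfold moebRem invZetaCoeff moebPart
  rcases Nat.eq_zero_or_pos n with rfl | hn
  · simp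
  · simp only [if_neg hn.ne']
    have h := abs_inv_zetaN_sub_sum_le (by omega : 2 ≤ n + 1) hK
    simpa using h

/-- `|moebRem K n| ≤ 1` for `K ≥ 1`. [folklore] -/
theorem abs_moebRem_le_one {K : ℕ} (hK : 1 ≤ K) (n : ℕ) : |moebRem K n| ≤ 1 :=
  (abs_moebRem_le hK n).trans (inv_le_one_of_one_le₀ (one_le_pow₀ (by exact_mod_cast hK)))

/-- One Möbius term: `Σ_{n≥1} (μ(k)/k^{n+1}) (zL)ⁿ/n! = (μ(k)/k)(e^{zL/k} − 1)` (also for `k = 0`, both sides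
being `0`). [cite: BrouckeDebruyneRevesz2023, §2 (2.5)] -/
theorem hasSum_moebius_term (k : ℕ) (w : ℂ) :
    HasSum (fun n : ℕ ↦ (((if n = 0 then 0 else (μ k : ℝ) / (k : ℝ) ^ (n + 1)) : ℝ) : ℂ) * w ^ n / n !)
      (((μ k : ℝ) : ℂ) / k * (Complex.exp (w / k) - 1)) := by
  rcases Nat.eq_zero_or_pos k with rfl | hk
  · simp only [ArithmeticFunction.map_zero, Int.cast_zero, zero_div, ite_self, Complex.ofReal_zero, zero_mul]
    exact hasSum_zero
  · have hk0 : (k : ℂ) ≠ 0 := by exact_mod_cast hk.ne'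
    have h := (hasSum_ite_pow_div_factorial (w / k)).mul_left (((μ k : ℝ) : ℂ) / k)
    refine h.congr_fun fun n ↦ ?_
    rcases Nat.eq_zero_or_pos n with rfl | hn
    · simp
    · simp only [if_neg hn.ne']
      push_cast
      rw [div_pow]
      field_simp
      ring

/-- **The Möbius splitting**: for `K ≥ 1`,
`liKernel z L = Σ_{k=0}^{K} (μ(k)/k)(e^{zL/k} − 1) + T` with `‖T‖ ≤ e^{‖z‖|L|/K} − 1` (the `k = 0` term vanishes).
[cite: BrouckeDebruyneRevesz2023, §2 (2.5) and proof of Lemma 3.1] -/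
theorem liKernel_eq_sum_add (z : ℂ) (L : ℝ) {K : ℕ} (hK : 1 ≤ K) :
    ∃ T : ℂ, ‖T‖ ≤ Real.exp (‖z‖ * |L| / K) - 1 ∧
      liKernel z L = ∑ k ∈ Finset.range (K + 1), ((μ k : ℝ) : ℂ) / k * (Complex.exp (z * L / k) - 1) + T := by
  set w : ℂ := z * L with hw
  -- the finite Möbius part
  have hS : HasSum (fun n : ℕ ↦ (moebPart K n : ℂ) * w ^ n / n !)
      (∑ k ∈ Finset.range (K + 1), ((μ k : ℝ) : ℂ) / k * (Complex.exp (w / k) - 1)) := by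
    have h := hasSum_sum (s := Finset.range (K + 1)) fun k _ ↦ hasSum_moebius_term k w
    refine h.congr_fun fun n ↦ ?_
    simp only [moebPart]
    rcases Nat.eq_zero_or_pos n with rfl | hn
    · simp
    · simp only [if_neg hn.ne']
      push_cast
      rw [Finset.sum_mul, Finset.sum_div]
  -- the remainder
  have hTs : Summable fun n : ℕ ↦ (moebRem K n : ℂ) * w ^ n / n ! := summable_coeff_mul_pow_div (abs_moebRem_le_one hK) w
  set T : ℂ := ∑' n : ℕ, (moebRem K n : ℂ) * w ^ n / n ! with hT
  have hTsum : HasSum (fun n : ℕ ↦ (moebRem K n : ℂ) * w ^ n / n !) T := hTs.hasSum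
  -- norm bound for `T`
  have hK0 : (0 : ℝ) < K := by exact_mod_cast hK
  have hbound : ∀ n : ℕ, ‖(moebRem K n : ℂ) * w ^ n / (n ! : ℂ)‖ ≤
      (if n = 0 then 0 else (‖z‖ * |L| / K) ^ n / n !) := by
    intro n
    rcases Nat.eq_zero_or_pos n with rfl | hn
    · simp [moebRem, invZetaCoeff, moebPart]
    · simp only [if_neg hn.ne']
      have h1 := norm_coeff_mul_pow_div_le (abs_moebRem_le hK n) w n
      have h2 : ‖w‖ = ‖z‖ * |L| := by rw [hw, norm_mul, norm_real, Real.norm_eq_abs]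
      rw [h2] at h1
      refine h1.trans (le_of_eq ?_)
      rw [div_pow]
      field_simp
  have hTnorm : ‖T‖ ≤ Real.exp (‖z‖ * |L| / K) - 1 :=
    tsum_of_norm_bounded (real_hasSum_ite_pow_div_factorial _) hbound
  refine ⟨T, hTnorm, ?_⟩
  -- assemble: the coefficient splits as `moebPart + moebRem`
  have hsum := hS.add hTsum
  have heq : (fun n : ℕ ↦ (invZetaCoeff n : ℂ) * w ^ n / n !) =
      fun n : ℕ ↦ (moebPart K n : ℂ) * w ^ n / n ! + (moebRem K n : ℂ) * w ^ n / n ! := by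
    funext n
    rw [moebRem]; push_cast; ring
  have h3 : HasSum (fun n : ℕ ↦ (invZetaCoeff n : ℂ) * w ^ n / n !) _ := heq ▸ hsum
  rw [liKernel, ← hw, h3.tsum_eq]

/-! ### The estimate for `0 ≤ Re z ≤ 1` -/

/-- `‖e^{v} − 1‖ ≤ e^{Re v} + 1`. [folklore] -/
theorem norm_exp_sub_one_le_exp_re_add_one (v : ℂ) : ‖Complex.exp v - 1‖ ≤ Real.exp v.re + 1 := by
  calc ‖Complex.exp v - 1‖ ≤ ‖Complex.exp v‖ + ‖(1 : ℂ)‖ := norm_sub_le _ _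
    _ = Real.exp v.re + 1 := by rw [Complex.norm_exp, norm_one]

/-- For `k ≥ 2`, `Re z ≤ 1`, `L ≥ 0`: `‖(μ(k)/k)(e^{zL/k} − 1)‖ ≤ (1/k)(e^{L/2} + 1)`. [cite: BrouckeDebruyneRevesz2023, proof of Lemma 3.1] -/
theorem norm_moebius_exp_term_le {k : ℕ} (hk : 2 ≤ k) {z : ℂ} (hz1 : z.re ≤ 1) {L : ℝ} (hL : 0 ≤ L) :
    ‖((μ k : ℝ) : ℂ) / k * (Complex.exp (z * L / k) - 1)‖ ≤ 1 / (k : ℝ) * (Real.exp (L / 2) + 1) := by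
  have hk0 : (0 : ℝ) < k := by exact_mod_cast (by omega : 0 < k)
  rw [norm_mul, norm_div, norm_real, Complex.norm_natCast, Real.norm_eq_abs]
  have h1 : |(μ k : ℝ)| / k ≤ 1 / k :=
    div_le_div_of_nonneg_right (by exact_mod_cast abs_moebius_le_one) hk0.le
  have h2 : ‖Complex.exp (z * L / k) - 1‖ ≤ Real.exp (L / 2) + 1 := by
    refine (norm_exp_sub_one_le_exp_re_add_one _).trans ?_
    have hre : (z * L / k).re = z.re * L / k := by
      rw [Complex.div_natCast_re]; simp
    rw [hre]
    have hk2 : (2 : ℝ) ≤ k := by exact_mod_cast hk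
    have : z.re * L / k ≤ L / 2 := by
      rw [div_le_div_iff₀ hk0 two_pos]
      nlinarith
    linarith [Real.exp_le_exp.2 this]
  exact mul_le_mul h1 h2 (norm_nonneg _) (by positivity)

/-- The harmonic number `H_K` (Mathlib's `harmonic K`, cast to `ℝ`) as `Σ_{k=0}^{K} 1/k` (the `k = 0` term is `0`).
[folklore] -/
theorem harmonic_cast_eq_sum (K : ℕ) : ((harmonic K : ℚ) : ℝ) = ∑ k ∈ Finset.range (K + 1), 1 / (k : ℝ) := by
  rw [harmonic, Finset.sum_range_succ']
  push_cast
  simp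

/-- `1 ≤ H_K` for `K ≥ 1`. [folklore] -/
theorem one_le_harmonic_cast {K : ℕ} (hK : 1 ≤ K) : 1 ≤ ((harmonic K : ℚ) : ℝ) := by
  rw [harmonic_cast_eq_sum]
  have h1 : (1 : ℕ) ∈ Finset.range (K + 1) := Finset.mem_range.2 (by omega)
  have h := Finset.single_le_sum (f := fun k : ℕ ↦ 1 / (k : ℝ)) (fun k _ ↦ by positivity) h1
  simpa using h

/-- **BDR's estimate for `x log x (d/dx) li(x^z)`** (fixed splitting): for `Re z ≤ 1`, `x ≥ 1`, `K ≥ 1` and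
`2‖z‖ ≤ K`,
`|Re liKernel z (log x) − Re (x^z − 1)| ≤ H_K (√x + 1)` (BDR: "`≪_Q √x log log x`", there with `K ≈ Q log x`).
[cite: BrouckeDebruyneRevesz2023, proof of Lemma 3.1] -/
theorem norm_liKernel_sub_le {z : ℂ} (hz1 : z.re ≤ 1) {x : ℝ} (hx : 1 ≤ x) {K : ℕ} (hK : 1 ≤ K)
    (hKz : 2 * ‖z‖ ≤ K) :
    ‖liKernel z (Real.log x) - ((x : ℂ) ^ z - 1)‖ ≤ ((harmonic K : ℚ) : ℝ) * (Real.sqrt x + 1) := by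
  have hx0 : 0 < x := by linarith
  have hL : 0 ≤ Real.log x := Real.log_nonneg hx
  have hK0 : (0 : ℝ) < K := by exact_mod_cast hK
  have hsqrt : Real.exp (Real.log x / 2) = Real.sqrt x := by
    rw [Real.sqrt_eq_rpow, Real.rpow_def_of_pos hx0]; ring_nf
  obtain ⟨T, hT, heq⟩ := liKernel_eq_sum_add z (Real.log x) hK
  -- the `k = 1` term is `x^z − 1`
  set a : ℕ → ℂ := fun k ↦ ((μ k : ℝ) : ℂ) / k * (Complex.exp (z * Real.log x / k) - 1) with ha
  have h1mem : (1 : ℕ) ∈ Finset.range (K + 1) := Finset.mem_range.2 (by omega)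
  have ha1 : a 1 = (x : ℂ) ^ z - 1 := by
    simp only [ha, Nat.cast_one, div_one, moebius_apply_one, Int.cast_one, Complex.ofReal_one, one_mul]
    rw [Complex.cpow_def_of_ne_zero (ofReal_ne_zero.2 hx0.ne'), ← Complex.ofReal_log hx0.le, mul_comm]
  have hsplit : ∑ k ∈ Finset.range (K + 1), a k = a 1 + ∑ k ∈ (Finset.range (K + 1)).erase 1, a k :=
    (Finset.add_sum_erase _ _ h1mem).symm
  -- bound the other terms
  have hrest : ‖∑ k ∈ (Finset.range (K + 1)).erase 1, a k‖ ≤ (((harmonic K : ℚ) : ℝ) - 1) * (Real.sqrt x + 1) := by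
    have hH : ((harmonic K : ℚ) : ℝ) - 1 = ∑ k ∈ (Finset.range (K + 1)).erase 1, 1 / (k : ℝ) := by
      rw [harmonic_cast_eq_sum, ← Finset.add_sum_erase _ _ h1mem]; simp
    rw [hH, Finset.sum_mul]
    refine (norm_sum_le _ _).trans (Finset.sum_le_sum fun k hk ↦ ?_)
    have hk1 : k ≠ 1 := (Finset.mem_erase.1 hk).1
    rcases Nat.eq_zero_or_pos k with rfl | hkpos
    · simp [ha]
    · have hk2 : 2 ≤ k := by omega
      have h := norm_moebius_exp_term_le hk2 hz1 hL
      rw [hsqrt] at h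
      exact h
  -- bound `T`
  have hTle : ‖T‖ ≤ Real.sqrt x := by
    refine hT.trans ?_
    rw [abs_of_nonneg hL]
    have : ‖z‖ * Real.log x / K ≤ Real.log x / 2 := by
      rw [div_le_div_iff₀ hK0 two_pos]
      nlinarith [norm_nonneg z]
    have h2 := Real.exp_le_exp.2 this
    rw [hsqrt] at h2
    linarith
  -- assemble
  have hdiff : liKernel z (Real.log x) - ((x : ℂ) ^ z - 1) = ∑ k ∈ (Finset.range (K + 1)).erase 1, a k + T := by
    rw [heq, hsplit, ha1]; ring
  rw [hdiff]
  have hH1 := one_le_harmonic_cast hK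
  have hsx : 0 ≤ Real.sqrt x := Real.sqrt_nonneg x
  calc ‖∑ k ∈ (Finset.range (K + 1)).erase 1, a k + T‖
      ≤ (((harmonic K : ℚ) : ℝ) - 1) * (Real.sqrt x + 1) + Real.sqrt x := (norm_add_le _ _).trans (add_le_add hrest hTle)
    _ ≤ ((harmonic K : ℚ) : ℝ) * (Real.sqrt x + 1) := by nlinarith

/-- Real-part form of `norm_liKernel_sub_le`: `|Re liKernel z (log x) − Re(x^z − 1)| ≤ H_K(√x + 1)`.
[cite: BrouckeDebruyneRevesz2023, proof of Lemma 3.1] -/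
theorem abs_re_liKernel_sub_le {z : ℂ} (hz1 : z.re ≤ 1) {x : ℝ} (hx : 1 ≤ x) {K : ℕ} (hK : 1 ≤ K)
    (hKz : 2 * ‖z‖ ≤ K) :
    |(liKernel z (Real.log x)).re - ((x : ℂ) ^ z - 1).re| ≤ ((harmonic K : ℚ) : ℝ) * (Real.sqrt x + 1) := by
  have h := norm_liKernel_sub_le hz1 hx hK hKz
  rw [← Complex.sub_re]
  exact (abs_re_le_norm _).trans h

/-! ### Real parts as power series in `log x` -/

/-- Real part of one term: `Re((c : ℂ)(zL)ⁿ/n!) = c · Re(zⁿ) · Lⁿ/n!` for real `c`, `L`. [folklore] -/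
theorem re_coeff_mul_pow_div (c : ℝ) (z : ℂ) (L : ℝ) (n : ℕ) :
    ((c : ℂ) * (z * L) ^ n / n !).re = c * (z ^ n).re * L ^ n / n ! := by
  rw [Complex.div_natCast_re, mul_pow, ← Complex.ofReal_pow, Complex.re_ofReal_mul, mul_comm (z ^ n),
    Complex.re_ofReal_mul]
  ring

/-- **`Re liKernel z L = logSeries (n ↦ invZetaCoeff n · Re zⁿ) L`.** [cite: BrouckeDebruyneRevesz2023, §2 (2.6)] -/
theorem re_liKernel_eq_logSeries (z : ℂ) (L : ℝ) :
    (liKernel z L).re = logSeries (fun n ↦ invZetaCoeff n * (z ^ n).re) L := by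
  have h := Complex.hasSum_re (hasSum_liKernel z L)
  simp only [re_coeff_mul_pow_div] at h
  rw [logSeries, ← h.tsum_eq]

/-- The coefficient bound for `n ↦ invZetaCoeff n · Re zⁿ`: `≤ 1 · ‖z‖ⁿ`. [folklore] -/
theorem abs_invZetaCoeff_mul_re_pow_le (z : ℂ) (n : ℕ) : |invZetaCoeff n * (z ^ n).re| ≤ 1 * ‖z‖ ^ n := by
  rw [abs_mul, one_mul]
  calc |invZetaCoeff n| * |(z ^ n).re| ≤ 1 * ‖z ^ n‖ :=
        mul_le_mul (abs_invZetaCoeff_le_one n) (abs_re_le_norm _) (abs_nonneg _) zero_le_one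
    _ = ‖z‖ ^ n := by rw [one_mul, norm_pow]

/-- **`Re(e^{zL} − 1) = logSeries (n ↦ [n ≥ 1] Re zⁿ) L`.** [cite: BrouckeDebruyneRevesz2023, §2 (2.5)] -/
theorem re_exp_sub_one_eq_logSeries (z : ℂ) (L : ℝ) :
    (Complex.exp (z * L) - 1).re = logSeries (fun n ↦ if n = 0 then 0 else (z ^ n).re) L := by
  have h := Complex.hasSum_re (hasSum_ite_pow_div_factorial (z * L))
  have h2 : ∀ n : ℕ, ((if n = 0 then (0 : ℂ) else (z * L) ^ n / n !)).re =
      (if n = 0 then 0 else (z ^ n).re) * L ^ n / n ! := by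
    intro n
    split_ifs with hn
    · simp
    · have := re_coeff_mul_pow_div 1 z L n
      simpa using this
  simp only [h2] at h
  rw [logSeries, ← h.tsum_eq]

/-- The coefficient bound for `n ↦ [n ≥ 1] Re zⁿ`: `≤ 1 · ‖z‖ⁿ`. [folklore] -/
theorem abs_ite_re_pow_le (z : ℂ) (n : ℕ) : |(if n = 0 then (0 : ℝ) else (z ^ n).re)| ≤ 1 * ‖z‖ ^ n := by
  split_ifs with h
  · simp
  · rw [one_mul]; exact (abs_re_le_norm _).trans (le_of_eq (norm_pow z n))

/-! ### The real case `z = δ ≥ 0` -/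

/-- For real `δ` the coefficients are `invZetaCoeff n · δⁿ`. [folklore] -/
theorem re_liKernel_ofReal (δ L : ℝ) : (liKernel δ L).re = logSeries (fun n ↦ invZetaCoeff n * δ ^ n) L := by
  rw [re_liKernel_eq_logSeries]
  congr 1
  funext n
  rw [← Complex.ofReal_pow, Complex.ofReal_re]

/-- **Lower bound `δL/2 ≤ Re liKernel δ L`** for `δ, L ≥ 0` (all terms are `≥ 0` and the first one is
`δL/ζ(2) ≥ δL/2`; BDR (2.7): "`(d/dx) li(x^δ) … > δ/(ζ(2)x) > δ/(2x)`"). [cite: BrouckeDebruyneRevesz2023, §2 (2.7)] -/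
theorem half_mul_le_re_liKernel {δ L : ℝ} (hδ : 0 ≤ δ) (hL : 0 ≤ L) : δ * L / 2 ≤ (liKernel δ L).re := by
  rw [re_liKernel_ofReal]
  have hc : ∀ n, |invZetaCoeff n * δ ^ n| ≤ 1 * δ ^ n := fun n ↦ by
    rw [abs_mul, abs_of_nonneg (pow_nonneg hδ n), one_mul]
    exact mul_le_of_le_one_left (pow_nonneg hδ n) (abs_invZetaCoeff_le_one n)
  have hc0 : ∀ n, 0 ≤ invZetaCoeff n * δ ^ n := fun n ↦ mul_nonneg (invZetaCoeff_nonneg n) (pow_nonneg hδ n)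
  have h := term_le_logSeries zero_le_one hc hc0 hL 1
  have h2 : δ * L / 2 ≤ invZetaCoeff 1 * δ ^ 1 * L ^ 1 / (1 ! : ℕ) := by
    simp only [invZetaCoeff, one_ne_zero, ↓reduceIte, pow_one, Nat.factorial_one, Nat.cast_one, div_one]
    have := half_le_inv_zetaN (le_refl 2)
    nlinarith [mul_nonneg hδ hL]
  exact h2.trans h

/-- **Upper bound `Re liKernel δ L ≤ e^{δL} − 1`** for `δ, L ≥ 0` (coefficients `≤ 1`). [cite: BrouckeDebruyneRevesz2023, §2] -/
theorem re_liKernel_le_exp_sub_one {δ L : ℝ} (hδ : 0 ≤ δ) (hL : 0 ≤ L) :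
    (liKernel δ L).re ≤ Real.exp (δ * L) - 1 := by
  rw [re_liKernel_ofReal]
  have hc : ∀ n, |invZetaCoeff n * δ ^ n| ≤ 1 * δ ^ n := fun n ↦ by
    rw [abs_mul, abs_of_nonneg (pow_nonneg hδ n), one_mul]
    exact mul_le_of_le_one_left (pow_nonneg hδ n) (abs_invZetaCoeff_le_one n)
  have hd : ∀ n, |(if n = 0 then (0 : ℝ) else δ ^ n)| ≤ 1 * δ ^ n := fun n ↦ by
    split_ifs
    · simp; positivity
    · rw [abs_of_nonneg (pow_nonneg hδ n), one_mul]
  have hcd : ∀ n, invZetaCoeff n * δ ^ n ≤ (if n = 0 then (0 : ℝ) else δ ^ n) := fun n ↦ by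
    split_ifs with h
    · simp [invZetaCoeff, h]
    · exact mul_le_of_le_one_left (pow_nonneg hδ n) (invZetaCoeff_le_one n)
  have h := logSeries_le_logSeries zero_le_one hc zero_le_one hd hcd hL
  refine h.trans (le_of_eq ?_)
  have h2 := (real_hasSum_ite_pow_div_factorial (δ * L)).tsum_eq
  rw [logSeries, ← h2]
  refine tsum_congr fun n ↦ ?_
  split_ifs <;> simp [mul_pow]

/-- Non-negativity `0 ≤ Re liKernel δ L` for `δ, L ≥ 0`. [folklore] -/
theorem re_liKernel_nonneg {δ L : ℝ} (hδ : 0 ≤ δ) (hL : 0 ≤ L) : 0 ≤ (liKernel δ L).re :=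
  le_trans (by positivity) (half_mul_le_re_liKernel hδ hL)

end Literature.NumberTheory.BeurlingPrimes
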